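import Literature.IUT.LogVolume.GenuineTowerLocalType
import Literature.IUT.LogVolume.SubThetaFieldRamificationThirty
import HarnessLib

/-!
# The LOCAL TYPE of the `l`-division tower of a genuine Θ-volume datum, SHARP form: `e(u | p) ∣ e(v₀ | p)·30·l`
# (twin of `GenuineTowerLocalType.lean` with this seat's cyclic-inertia bound `e(w | v₀) ∣ 30`; proof-only)

Mochizuki, *Inter-universal Teichmüller theory IV* (RIMS manuscript Apr. 2020 = PRIMS **57** (2021)), Thm. 1.10,
Steps (ii)–(iii) p. 24–26 (the tower `ℚ ⊆ F_tpd ⊆ F ⊆ K = F(E_F[l])`); J.-P. Serre, *Local Fields*, Ch. IV §2 Cor. 1 of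
Prop. 7 (tame inertia is cyclic); J.-P. Serre, Invent. Math. **15** (1972), §1.11–§1.12.

`GenuineTowerLocalType.lean` (this seat) proves `e(u | p) ∣ e(v₀ | p)·60·l` for a place `u` of the `l`-division field
`K` of a genuine Θ-volume datum, of residue characteristic `p ∉ {2, 3, 5, l}`, over a BAD place `v₀` of `λ`, from
`e(w | v₀) ∣ 60` (`SubThetaFieldRamificationSixty`). With the cyclic-inertia sharpening `e(w | v₀) ∣ 30`
(`Cor22.ramificationIdx_subThetaField_dvd_thirty`, `SubThetaFieldRamificationThirty.lean`) the same tower bookkeeping gives: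

* `ThetaVolumeDatumAt.ramificationIdx_tpd_F_dvd_thirty` — `e(w | v₀) ∣ 30` for the datum's `F/F_tpd`;
* **`ThetaVolumeDatumAt.ramificationIdx_int_dvd_thirty_mul`** — `e(u | p) ∣ e(v₀ | p) · 30 · l`;
* **`ThetaVolumeDatumAt.ramificationIdx_int_dvd_thirty_mul_ratPoint`** / **`…_ratPoint'`** — at a rational point:
  **`e(u | p) ∣ 30 · l`** — the EXACT local type of the Tate curve at a multiplicative prime
  (`e ∈ {e_x·l, 2e_x·l}`, `e_x ∣ 15`; abc-iut rw-num-lead WINDOW-TABLE v1 A1).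

Proof-only (no definition, no named fact); inputs BY NAME; classical; TAKES NO SIDE on [IUTchIII] Cor. 3.12.
[cite: Mochizuki2012, IUTchIV Thm. 1.10 proof Steps (ii)–(iii) p. 24–26] [claim: Mochizuki2012, status: disputed] for every IUT quotation.
-/

noncomputable section

open scoped Classical

namespace Literature.IUT.LogVolume

namespace Cor22

open NumberField IsDedekindDomain Literature.NumberTheory.DiophantineGeometry.GenEll
open Literature.NumberTheory.EllipticCurves Literature.NumberTheory.NumberFields Literature.IUT.HodgeTheaters
open WeierstrassCurve IntermediateField Field

namespace ThetaVolumeDatumAt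

variable {P : NFPoint} {l : ℕ} (T : ThetaVolumeDatumAt P l)

/-- **`F/F_tpd` layer of a genuine Θ-volume datum, sharp: `e(w | w ∩ F_tpd) ∣ 30`** at every place `w` of `F` of
residue characteristic `∉ {2, 3, 5}` over a BAD place of `λ` (this seat's `ramificationIdx_subThetaField_dvd_thirty`).
[cite: SerreLocalFields1979, Ch. IV §2 Cor. 1 of Prop. 7] [cite: Mochizuki2012, IUTchIV Thm. 1.10 proof Step (iii) (R2)–(R4) p. 25–26]
[claim: Mochizuki2012, status: disputed] -/
theorem ramificationIdx_tpd_F_dvd_thirty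
    (w : letI := T.instFieldF; letI := T.instNumberFieldF; HeightOneSpectrum (𝓞 T.F))
    (hw : letI := T.instFieldF; letI := T.instNumberFieldF; residueChar T.F w ∉ ({2, 3, 5} : Finset ℕ))
    (hbad : letI := T.instFieldF; letI := T.instNumberFieldF; letI := T.instAlgebraF
      finBelow P.F T.F w ∈ badPlaces P) :
    (letI := T.instFieldF; letI := T.instNumberFieldF; letI := T.instAlgebraF
     w.asIdeal.ramificationIdx (𝓞 P.F)) ∣ 30 := by
  letI := T.instFieldF; letI := T.instNumberFieldF; letI := T.instAlgebraF; letI := T.instFieldK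
  letI := T.instNumberFieldK; letI := T.instAlgebraK; letI := T.instFieldFbar; letI := T.instAlgebraFbar
  letI := T.instAlgebraKFbar; letI := T.instIsElliptic
  haveI : IsGalois P.F T.F := (T.towerFacts T.inU).1
  exact ramificationIdx_subThetaField_dvd_thirty T.F T.inU T.isSubThetaField w hbad
    (thirty_notMem_finBelow_of_residueChar_notMem w hw)

/-- **THE SHARP LOCAL TYPE: `e(u | p) ∣ e(v₀ | p) · 30 · l`** for every place `u` of the `l`-division field `K` of a
genuine Θ-volume datum, of residue characteristic `p ∉ {2, 3, 5, l}`, over a BAD place `v₀ = u ∩ F_tpd` of `λ`.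
[cite: Mochizuki2012, IUTchIV Thm. 1.10 proof Steps (ii)–(iii) p. 24–26] [cite: NeukirchANT1999, Ch. II Prop. (6.8)]
[claim: Mochizuki2012, status: disputed] -/
theorem ramificationIdx_int_dvd_thirty_mul
    (u : letI := T.instFieldK; letI := T.instNumberFieldK; HeightOneSpectrum (𝓞 T.K))
    (hu : letI := T.instFieldK; letI := T.instNumberFieldK; residueChar T.K u ∉ ({2, 3, 5, l} : Finset ℕ))
    (hbad : letI := T.instFieldF; letI := T.instNumberFieldF; letI := T.instAlgebraF; letI := T.instFieldK
      letI := T.instNumberFieldK; letI := T.instAlgebraK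
      finBelow P.F T.F (finBelow T.F T.K u) ∈ badPlaces P) :
    (letI := T.instFieldK; letI := T.instNumberFieldK
     u.asIdeal.ramificationIdx ℤ) ∣
      (letI := T.instFieldF; letI := T.instNumberFieldF; letI := T.instAlgebraF; letI := T.instFieldK
       letI := T.instNumberFieldK; letI := T.instAlgebraK
       (finBelow P.F T.F (finBelow T.F T.K u)).asIdeal.ramificationIdx ℤ) * 30 * l := by
  letI := T.instFieldF; letI := T.instNumberFieldF; letI := T.instAlgebraF; letI := T.instFieldK
  letI := T.instNumberFieldK; letI := T.instAlgebraK; letI := T.instFieldFbar; letI := T.instAlgebraFbar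
  letI := T.instAlgebraKFbar; letI := T.instIsElliptic
  simp only [Finset.mem_insert, Finset.mem_singleton, not_or] at hu
  obtain ⟨h2, h3, h5, hul⟩ := hu
  set w := finBelow T.F T.K u with hwdef
  set v₀ := finBelow P.F T.F w with hv₀def
  have hw : residueChar T.F w ∉ ({2, 3, 5} : Finset ℕ) := by
    rw [hwdef, residueChar_finBelow]
    simp only [Finset.mem_insert, Finset.mem_singleton, not_or]
    exact ⟨h2, h3, h5⟩
  have hKF : u.asIdeal.ramificationIdx (𝓞 T.F) ∣ l := T.ramificationIdx_dvd_prime u hul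
  have hFtpd : w.asIdeal.ramificationIdx (𝓞 P.F) ∣ 30 := T.ramificationIdx_tpd_F_dvd_thirty w hw hbad
  have hw_under : u.under (𝓞 T.F) = w := rfl
  have hv_under : w.under (𝓞 P.F) = v₀ := rfl
  haveI : w.asIdeal.IsMaximal := w.isMaximal
  haveI : v₀.asIdeal.IsMaximal := v₀.isMaximal
  have heuw : Ideal.ramificationIdx' w.asIdeal u.asIdeal = u.asIdeal.ramificationIdx (𝓞 T.F) :=
    Ideal.ramificationIdx'_eq_ramificationIdx w.asIdeal u.asIdeal w.ne_bot
  have hewv : Ideal.ramificationIdx' v₀.asIdeal w.asIdeal = w.asIdeal.ramificationIdx (𝓞 P.F) :=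
    Ideal.ramificationIdx'_eq_ramificationIdx v₀.asIdeal w.asIdeal v₀.ne_bot
  have heu : u.asIdeal.ramificationIdx ℤ =
      v₀.asIdeal.ramificationIdx ℤ * w.asIdeal.ramificationIdx (𝓞 P.F) * u.asIdeal.ramificationIdx (𝓞 T.F) := by
    rw [ThetaData.absRamificationIdx_eq_ramIdx_mul (F := T.F) u, hw_under,
      ramIdx_eq, ThetaData.absRamificationIdx_eq_ramIdx_mul (F := P.F) w, hv_under, ramIdx_eq, heuw, hewv]
  rw [heu]
  exact mul_dvd_mul (mul_dvd_mul dvd_rfl hFtpd) hKF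

/-- **At a RATIONAL point: `e(u | p) ∣ 30 · l`** for every place `u` of the `l`-division field `K` of a genuine
Θ-volume datum at `(ratPoint q, l)`, of residue characteristic `p ∉ {2, 3, 5, l}`, over a pole of `j(q)`.
[cite: Mochizuki2012, IUTchIV Thm. 1.10 proof Steps (ii)–(iii) p. 24–26] [cite: SerreLocalFields1979, Ch. IV §2 Cor. 1 of Prop. 7]
[claim: Mochizuki2012, status: disputed] -/
theorem ramificationIdx_int_dvd_thirty_mul_ratPoint {q : ℚ} {l : ℕ} (T : ThetaVolumeDatumAt (ratPoint q) l)
    (u : letI := T.instFieldK; letI := T.instNumberFieldK; HeightOneSpectrum (𝓞 T.K))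
    (hu : letI := T.instFieldK; letI := T.instNumberFieldK; residueChar T.K u ∉ ({2, 3, 5, l} : Finset ℕ))
    (hbad : letI := T.instFieldF; letI := T.instNumberFieldF; letI := T.instAlgebraF; letI := T.instFieldK
      letI := T.instNumberFieldK; letI := T.instAlgebraK
      finBelow (ratPoint q).F T.F (finBelow T.F T.K u) ∈ badPlaces (ratPoint q)) :
    (letI := T.instFieldK; letI := T.instNumberFieldK
     u.asIdeal.ramificationIdx ℤ) ∣ 30 * l := by
  letI := T.instFieldF; letI := T.instNumberFieldF; letI := T.instAlgebraF; letI := T.instFieldK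
  letI := T.instNumberFieldK; letI := T.instAlgebraK
  have h := T.ramificationIdx_int_dvd_thirty_mul u hu hbad
  have h1 : (finBelow (ratPoint q).F T.F (finBelow T.F T.K u)).asIdeal.ramificationIdx ℤ = 1 :=
    Literature.NumberTheory.EllipticCurves.Fisher2016.ramificationIdx_int_rat_eq_one _
  rw [h1, one_mul] at h
  exact h

/-- The same with the bad place given by its residue characteristic `p ∉ {2, 3, 5, l}` (`ord_p j(q) < 0` at every
place of `ℚ` over `p`): `e(u | p) ∣ 30 · l`. [cite: Mochizuki2012, IUTchIV Thm. 1.10 proof Steps (ii)–(iii) p. 24–26]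
[claim: Mochizuki2012, status: disputed] -/
theorem ramificationIdx_int_dvd_thirty_mul_ratPoint' {q : ℚ} {l : ℕ} (T : ThetaVolumeDatumAt (ratPoint q) l)
    {p : ℕ} (hp : p ∉ ({2, 3, 5, l} : Finset ℕ))
    (hpole : ∀ v : HeightOneSpectrum (𝓞 ℚ), Rat.HeightOneSpectrum.natGenerator v = p →
      ord ℚ v (jInv q) < 0)
    (u : letI := T.instFieldK; letI := T.instNumberFieldK; HeightOneSpectrum (𝓞 T.K))
    (hu : letI := T.instFieldK; letI := T.instNumberFieldK; residueChar T.K u = p) :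
    (letI := T.instFieldK; letI := T.instNumberFieldK
     u.asIdeal.ramificationIdx ℤ) ∣ 30 * l := by
  letI := T.instFieldF; letI := T.instNumberFieldF; letI := T.instAlgebraF; letI := T.instFieldK
  letI := T.instNumberFieldK; letI := T.instAlgebraK
  refine T.ramificationIdx_int_dvd_thirty_mul_ratPoint u (by rw [hu]; exact hp) ?_
  set v : HeightOneSpectrum (𝓞 ℚ) := finBelow (ratPoint q).F T.F (finBelow T.F T.K u) with hvdef
  have hvp : Rat.HeightOneSpectrum.natGenerator v = p := by
    have hchar : residueChar ℚ v = p := by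
      rw [hvdef]
      change residueChar (ratPoint q).F (finBelow (ratPoint q).F T.F (finBelow T.F T.K u)) = p
      rw [residueChar_finBelow, residueChar_finBelow, hu]
    have hpp : p.Prime := hchar ▸ residueChar_prime ℚ v
    have hmem : ((p : ℕ) : 𝓞 ℚ) ∈ v.asIdeal := by
      rw [natCast_mem_asIdeal_iff_residueChar_eq v hpp]; exact hchar
    have hdvd := (Literature.NumberTheory.DiophantineGeometry.UniformABCConjecture.natCast_mem_asIdeal_iff v p).1 hmem
    exact (Nat.prime_dvd_prime_iff_eq (Rat.HeightOneSpectrum.prime_natGenerator v) hpp).1 hdvd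
  exact (mem_badPlaces_iff_ord_neg (ratPoint q) v).2 (hpole v hvp)

end ThetaVolumeDatumAt

end Cor22

end Literature.IUT.LogVolume

end
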